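import Mathlib.NumberTheory.ArithmeticFunction.Misc
import Mathlib.Data.Nat.Squarefree
import Mathlib.Data.Finset.Sort
import HarnessLib

/-!
# The Friedlander–Iwaniec small-divisor lemma (squarefree case)

Trunk T-SIEVE. Source: J. Friedlander, H. Iwaniec, *The polynomial `X² + Y⁴` captures its primes*,
Ann. of Math. 148 (1998) 945–1040 [FriedlanderIwaniecAnnals1998], Lemma 2.2 (whose first two
statements are, loc. cit., Lemmata 1 and 2 of J. Friedlander, H. Iwaniec, *Asymptotic sieve for
primes*, Ann. of Math. 148 (1998) 1041–1065 [FriedlanderIwaniecASP1998]); it is the combinatorial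
input of the reduction of the hypotheses (R), (B) of the asymptotic sieve for primes to their
`τ₅`-weighted forms (R′), (B′) (Harman, *Prime-Detecting Sieves*, (12.9.18)–(12.9.19)).

* `Squarefree.exists_dvd_pow_le_card_divisors_le` (PROVED): for `k ≥ 1` and `n` squarefree there is
  `d ∣ n` with `d^k ≤ n` (i.e. `d ≤ n^{1/k}`) and `τ(n) ≤ (2 τ(d))^k`.

Proof: list the prime factors `p₀ < p₁ < ⋯ < p_{r-1}` of `n`, put `m = ⌊r/k⌋` and
`d = p₀ ⋯ p_{m-1}`; then `d ≤ p_{jm} ⋯ p_{jm+m-1}` for each `j < k`, so `d^k ≤ p₀ ⋯ p_{km-1} ≤ n`, and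
`τ(n) = 2^r ≤ 2^{k(m+1)} = (2 τ(d))^k`.

Mathlib has `Nat.divisors`, `Nat.primeFactors`, `Nat.card_divisors`, `Finset.orderEmbOfFin`; no form of
this lemma (`rg "2 \* .*divisors.*card.*\^"` in Mathlib: nothing relevant).
-/

open Finset

namespace Literature.NumberTheory.Sieve

/-- Auxiliary enumeration: the `i`-th smallest prime factor of `n` for `i < ω(n)`, and `1` beyond.
[folklore] -/
noncomputable def nthPrimeFactor (n i : ℕ) : ℕ :=
  if h : i < n.primeFactors.card then n.primeFactors.orderEmbOfFin rfl ⟨i, h⟩ else 1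

/-- Unfolding `nthPrimeFactor` inside the range `i < ω(n)`. [folklore] -/
theorem nthPrimeFactor_of_lt {n i : ℕ} (h : i < n.primeFactors.card) :
    nthPrimeFactor n i = n.primeFactors.orderEmbOfFin rfl ⟨i, h⟩ := by
  simp [nthPrimeFactor, h]

/-- The `i`-th smallest prime factor is a prime factor. [folklore] -/
theorem nthPrimeFactor_mem {n i : ℕ} (h : i < n.primeFactors.card) :
    nthPrimeFactor n i ∈ n.primeFactors := by
  rw [nthPrimeFactor_of_lt h]
  exact Finset.orderEmbOfFin_mem _ _ _

/-- `nthPrimeFactor n i ≥ 1` (a prime, or the junk value `1`). [folklore] -/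
theorem one_le_nthPrimeFactor (n i : ℕ) : 1 ≤ nthPrimeFactor n i := by
  by_cases h : i < n.primeFactors.card
  · exact (Nat.prime_of_mem_primeFactors (nthPrimeFactor_mem h)).one_lt.le
  · simp [nthPrimeFactor, h]

/-- The enumeration of prime factors is increasing. [folklore] -/
theorem nthPrimeFactor_mono {n i j : ℕ} (hij : i ≤ j) (hj : j < n.primeFactors.card) :
    nthPrimeFactor n i ≤ nthPrimeFactor n j := by
  rw [nthPrimeFactor_of_lt (hij.trans_lt hj), nthPrimeFactor_of_lt hj]
  exact (Finset.orderEmbOfFin _ _).monotone hij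

/-- The enumeration of prime factors is injective on `i < ω(n)`. [folklore] -/
theorem nthPrimeFactor_injOn (n : ℕ) :
    Set.InjOn (nthPrimeFactor n) (Finset.range n.primeFactors.card : Set ℕ) := by
  intro i hi j hj hij
  simp only [Finset.coe_range, Set.mem_Iio] at hi hj
  rw [nthPrimeFactor_of_lt hi, nthPrimeFactor_of_lt hj] at hij
  exact congrArg Fin.val ((Finset.orderEmbOfFin _ _).injective hij)

/-- `∏_{i < ω(n)} p_i = n` for squarefree `n`. [folklore] -/
theorem prod_range_nthPrimeFactor {n : ℕ} (hn : Squarefree n) :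
    ∏ i ∈ Finset.range n.primeFactors.card, nthPrimeFactor n i = n := by
  rw [← Fin.prod_univ_eq_prod_range]
  have h1 : ∏ i : Fin n.primeFactors.card, nthPrimeFactor n i =
      ∏ i : Fin n.primeFactors.card, n.primeFactors.orderEmbOfFin rfl i :=
    Finset.prod_congr rfl fun i _ => by rw [nthPrimeFactor_of_lt i.2]
  have h2 : ∏ i : Fin n.primeFactors.card, n.primeFactors.orderEmbOfFin rfl i =
      ∏ p ∈ Finset.univ.map (n.primeFactors.orderEmbOfFin rfl).toEmbedding, p := by
    rw [Finset.prod_map]; rfl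
  rw [h1, h2, Finset.map_orderEmbOfFin_univ]
  exact Nat.prod_primeFactors_of_squarefree hn

/-- **Friedlander–Iwaniec small-divisor lemma, squarefree case.** For `k ≥ 1` and `n` squarefree there
is a divisor `d ∣ n` with `d^k ≤ n` (that is, `d ≤ n^{1/k}`) such that `τ(n) ≤ (2 τ(d))^k`.
[cite: FriedlanderIwaniecAnnals1998, Lemma 2.2] -/
theorem Squarefree.exists_dvd_pow_le_card_divisors_le {k : ℕ} (hk : 1 ≤ k) {n : ℕ}
    (hn : Squarefree n) :
    ∃ d : ℕ, d ∣ n ∧ d ^ k ≤ n ∧ n.divisors.card ≤ (2 * d.divisors.card) ^ k := by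
  have hn0 : n ≠ 0 := hn.ne_zero
  set r := n.primeFactors.card with hr
  set m := r / k with hm
  set f := nthPrimeFactor n with hf
  have hkm : k * m ≤ r := Nat.mul_div_le r k
  have hmr : m ≤ r := Nat.div_le_self r k
  -- the divisor
  set d := ∏ i ∈ Finset.range m, f i with hd
  -- `d` divides `n`
  have hd_dvd : d ∣ n := by
    rw [← prod_range_nthPrimeFactor hn]
    exact Finset.prod_dvd_prod_of_subset _ _ _ (Finset.range_subset_range.mpr hmr)
  -- `d ≤` each block product
  have hblock : ∀ j, j < k → d ≤ ∏ i ∈ Finset.range m, f (j * m + i) := by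
    intro j hj
    refine Finset.prod_le_prod (fun i _ => Nat.zero_le _) fun i hi => ?_
    have him : i < m := Finset.mem_range.mp hi
    refine nthPrimeFactor_mono (Nat.le_add_left i (j * m)) ?_
    calc j * m + i < j * m + m := by omega
      _ = (j + 1) * m := by ring
      _ ≤ k * m := Nat.mul_le_mul_right m hj
      _ ≤ r := hkm
  -- `∏_{i < j m} f i = ∏_{j' < j} ∏_{i < m} f (j' m + i)`
  have hsplit : ∀ j, ∏ i ∈ Finset.range (j * m), f i =
      ∏ j' ∈ Finset.range j, ∏ i ∈ Finset.range m, f (j' * m + i) := by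
    intro j
    induction j with
    | zero => simp
    | succ j ih =>
      rw [Finset.prod_range_succ, ← ih, Nat.succ_mul, Finset.prod_range_add]
  have hdk : d ^ k ≤ n := by
    calc d ^ k = ∏ _j ∈ Finset.range k, d := by rw [Finset.prod_const, Finset.card_range]
      _ ≤ ∏ j ∈ Finset.range k, ∏ i ∈ Finset.range m, f (j * m + i) :=
          Finset.prod_le_prod (fun _ _ => Nat.zero_le _) fun j hj => hblock j (Finset.mem_range.mp hj)
      _ = ∏ i ∈ Finset.range (k * m), f i := (hsplit k).symm
      _ ≤ ∏ i ∈ Finset.range r, f i :=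
          Finset.prod_le_prod_of_subset_of_one_le' (Finset.range_subset_range.mpr hkm)
            fun i _ _ => one_le_nthPrimeFactor n i
      _ = n := prod_range_nthPrimeFactor hn
  -- prime factors of `d`
  have hT : d = ∏ p ∈ (Finset.range m).image f, p := by
    rw [Finset.prod_image]
    exact fun i hi j hj hij => nthPrimeFactor_injOn n
      (Finset.range_subset_range.mpr hmr hi) (Finset.range_subset_range.mpr hmr hj) hij
  have hTprime : ∀ p ∈ (Finset.range m).image f, p.Prime := by
    intro p hp
    obtain ⟨i, hi, rfl⟩ := Finset.mem_image.mp hp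
    exact Nat.prime_of_mem_primeFactors
      (nthPrimeFactor_mem ((Finset.mem_range.mp hi).trans_le hmr))
  have hdpf : d.primeFactors = (Finset.range m).image f := by
    rw [hT]; exact Nat.primeFactors_prod hTprime
  have hcardT : ((Finset.range m).image f).card = m := by
    rw [Finset.card_image_of_injOn, Finset.card_range]
    exact fun i hi j hj hij => nthPrimeFactor_injOn n
      (Finset.range_subset_range.mpr hmr hi) (Finset.range_subset_range.mpr hmr hj) hij
  have hd0 : d ≠ 0 := by
    rw [hT]; exact Finset.prod_ne_zero_iff.mpr fun p hp => (hTprime p hp).ne_zero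
  -- `2^m ≤ τ(d)`
  have htaud : 2 ^ m ≤ d.divisors.card := by
    rw [Nat.card_divisors hd0, hdpf]
    calc 2 ^ m = ∏ _p ∈ (Finset.range m).image f, 2 := by rw [Finset.prod_const, hcardT]
      _ ≤ ∏ p ∈ (Finset.range m).image f, (d.factorization p + 1) := by
          refine Finset.prod_le_prod (fun _ _ => Nat.zero_le _) fun p hp => ?_
          have hp' : p ∈ d.factorization.support := by
            rw [Nat.support_factorization, hdpf]; exact hp
          have := Finsupp.mem_support_iff.mp hp'
          omega
  -- `τ(n) ≤ 2^r`
  have htaun : n.divisors.card ≤ 2 ^ r := by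
    rw [Nat.card_divisors hn0, hr, ← Finset.prod_const]
    refine Finset.prod_le_prod (fun _ _ => Nat.zero_le _) fun p _ => ?_
    have := hn.natFactorization_le_one p
    omega
  refine ⟨d, hd_dvd, hdk, htaun.trans ?_⟩
  calc 2 ^ r ≤ 2 ^ (k * (m + 1)) :=
        Nat.pow_le_pow_right (by norm_num) (Nat.lt_mul_div_succ r hk).le
    _ = (2 * 2 ^ m) ^ k := by rw [← pow_succ', ← pow_mul, mul_comm]
    _ ≤ (2 * d.divisors.card) ^ k := Nat.pow_le_pow_left (Nat.mul_le_mul_left 2 htaud) k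

end Literature.NumberTheory.Sieve
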